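import Literature.NumberTheory.Transcendental.QuadraticRelationsLogarithmsResultantZ
import Literature.NumberTheory.Transcendental.QuadraticRelationsLogarithmsLemma38
import Literature.NumberTheory.Transcendental.GelfondCriterionProofs
import Mathlib.Analysis.Complex.ExponentialBounds
import HarnessLib

/-!
# Roy–Waldschmidt 1997, Proposition 3.9 (a small power of an irreducible polynomial)

Sixth brick of §3 of D. Roy, M. Waldschmidt, *Approximation diophantienne et indépendance
algébrique de logarithmes*, Ann. Sci. ÉNS (4) 30 (1997), towards Théorème 3.2 (ingredient of the
proof of their Théorème 1.1, whose corollary Théorème 0.2 is the tree's named fact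
`Literature.NumberTheory.Transcendental.royWaldschmidt_quadratic_thm_0_2`).

**Proposition 3.9** (p. 768). "Soit `θ ∈ ℂ` et soit `b ∈ ℝ` avec `0 < b < 1/16`. Alors, pour tout
entier `δ` assez grand et tout nombre réel `μ ≥ δ`, il existe un polynôme non nul `Q ∈ ℤ[X]` qui est
une puissance d'un polynôme irréductible de `ℤ[X]` et qui vérifie `deg(Q) ≤ δ`, `log M(Q) ≤ μ` et
`|Q(θ)| ≤ exp(-bδμ)`."  PROVED as `RoyWaldschmidt1997.prop_3_9`.

Proof as printed: Lemme 3.8 (`lemme_3_8`) with `a = 4b + 1/4` gives `P`; write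
`P = ± ∏ P_q` with `P_q = q^{c_q}` over the distinct normalized irreducible factors `q` of `P`
(blocks; pairwise coprime over `ℚ` by Gauss's lemma, `Polynomial.associated_of_not_isCoprime`);
order the non-constant blocks by the distance from `θ` to their roots and let `F` be the product of
the (at most) four closest blocks, `G` the rest; if there are fewer than four non-constant blocks,
`|F(θ)| ≤ |P(θ)|`; otherwise Lemme 3.4 (`resultant_wirsing`, with the four closest roots as close
roots — a tie-robust form of the appeal to Proposition 3.6) gives
`-4 log |G(θ)| ≤ (log 2) deg F deg G + deg G log M(F) + (deg F - 4) log M(G) ≤ δμ`, whence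
`log |F(θ)| ≤ -aδμ + δμ/4 = -4bδμ`; finally one of the (at most four) blocks of `F` has
`log |P_q(θ)| ≤ -bδμ`.  No definitions, no named facts.

## References

* [RoyWaldschmidt1997ENS] D. Roy, M. Waldschmidt, Ann. Sci. ÉNS (4) 30 (1997) 753–796, §3 (iii)
  Proposition 3.9, p. 768 (lit key paper:doi-10-1016-s0012-9593-97-89938-7, PDF p. 17).
-/

noncomputable section

open Polynomial Multiset UniqueFactorizationMonoid

namespace Literature.NumberTheory.Transcendental

namespace RoyWaldschmidt1997

/-! ### Small lemmas -/

/-- Greedy choice of the `k` smallest elements of a finset for a real key. [folklore] -/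
theorem exists_smallest_finset {ι : Type*} [DecidableEq ι] (s : Finset ι) (d : ι → ℝ) :
    ∀ k ≤ s.card, ∃ t ⊆ s, t.card = k ∧ ∀ x ∈ t, ∀ y ∈ s \ t, d x ≤ d y := by
  intro k
  induction k with
  | zero => intro _; exact ⟨∅, Finset.empty_subset _, rfl, fun x hx => by simp at hx⟩
  | succ k ih =>
    intro hk
    obtain ⟨t, hts, hcard, hord⟩ := ih (Nat.le_of_succ_le hk)
    have hne : (s \ t).Nonempty := by
      rw [Finset.nonempty_iff_ne_empty]; intro h0
      have := Finset.card_sdiff_add_card_eq_card hts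
      rw [h0, Finset.card_empty] at this; omega
    obtain ⟨γ, hγmem, hγmin⟩ := Finset.exists_min_image (s \ t) d hne
    refine ⟨insert γ t, Finset.insert_subset (Finset.mem_sdiff.mp hγmem).1 hts, ?_, ?_⟩
    · rw [Finset.card_insert_of_notMem (Finset.mem_sdiff.mp hγmem).2, hcard]
    · intro x hx y hy
      have hy' : y ∈ s \ t := by
        rw [Finset.mem_sdiff] at hy ⊢
        exact ⟨hy.1, fun h => hy.2 (Finset.mem_insert_of_mem h)⟩
      rcases Finset.mem_insert.mp hx with rfl | hx
      · exact hγmin y hy'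
      · exact (hord x hx γ hγmem).trans (hγmin y hy')

/-- Monotonicity of `Multiset.bind` in the function. [folklore] -/
theorem bind_mono {ι α : Type*} (s : Multiset ι) {f g : ι → Multiset α} (h : ∀ i ∈ s, f i ≤ g i) :
    s.bind f ≤ s.bind g := by
  induction s using Multiset.induction_on with
  | empty => simp
  | cons a s ih =>
    rw [cons_bind, cons_bind]
    exact add_le_add (h a (mem_cons_self a s)) (ih fun i hi => h i (mem_cons_of_mem hi))

/-- Coprimality with a unit. [folklore] -/
theorem isCoprime_of_isUnit_right {R : Type*} [CommRing R] (a : R) {u : R} (hu : IsUnit u) :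
    IsCoprime a u := by
  obtain ⟨v, hv⟩ := hu.exists_left_inv
  exact ⟨0, v, by rw [zero_mul, zero_add, hv]⟩

/-- The arithmetic of p. 768: `m, n, u, v ≥ 0`, `m + n ≤ δ ≤ μ`, `u + v ≤ μ` give
`0.7 m n + n u + m v ≤ δ μ`. [cite: RoyWaldschmidt1997ENS, §3 (iii) proof of Proposition 3.9 ("le membre de droite … est ≤ δμ")] -/
theorem deg_mahler_bound {m n u v δ μ : ℝ} (hm : 0 ≤ m) (hn : 0 ≤ n) (hu : 0 ≤ u) (hv : 0 ≤ v)
    (hmn : m + n ≤ δ) (hδμ : δ ≤ μ) (huv : u + v ≤ μ) : 0.7 * m * n + n * u + m * v ≤ δ * μ := by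
  rcases le_total n m with h | h
  · -- `n ≤ m`: `nu + mv ≤ m(u+v) ≤ mμ`, `0.7mn + mμ ≤ (δ-n)(μ+0.7n) ≤ δμ`
    nlinarith [mul_le_mul_of_nonneg_left huv hm, mul_le_mul_of_nonneg_right h hu,
      mul_nonneg hn (by linarith : (0 : ℝ) ≤ μ - 0.7 * δ), mul_nonneg hn hn]
  · nlinarith [mul_le_mul_of_nonneg_left huv hn, mul_le_mul_of_nonneg_right h hv,
      mul_nonneg hm (by linarith : (0 : ℝ) ≤ μ - 0.7 * δ), mul_nonneg hm hm]

/-! ### Proposition 3.9 -/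

/-- **Roy–Waldschmidt 1997, Proposition 3.9.**  For `θ ∈ ℂ` and `0 < b < 1/16`, for every
sufficiently large integer `δ` and every real `μ ≥ δ` there is `Q ∈ ℤ[X]`, `Q ≠ 0`, a (positive)
power of an irreducible polynomial of `ℤ[X]`, with `deg Q ≤ δ`, `log M(Q) ≤ μ` and
`|Q(θ)| ≤ e^{-bδμ}`. [cite: RoyWaldschmidt1997ENS, §3 (iii) Proposition 3.9, p. 768] -/
theorem prop_3_9 (θ : ℂ) {b : ℝ} (hb0 : 0 < b) (hb : b < 1 / 16) :
    ∃ δ₀ : ℕ, ∀ δ : ℕ, δ₀ ≤ δ → ∀ μ : ℝ, (δ : ℝ) ≤ μ →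
      ∃ Q : ℤ[X], Q ≠ 0 ∧ (∃ (R : ℤ[X]) (k : ℕ), Irreducible R ∧ 0 < k ∧ Q = R ^ k) ∧
        Q.natDegree ≤ δ ∧ Real.log (Q.map (Int.castRingHom ℂ)).mahlerMeasure ≤ μ ∧
        ‖aeval θ Q‖ ≤ Real.exp (-(b * δ * μ)) := by
  classical
  set a : ℝ := 4 * b + 1 / 4 with ha
  have ha0 : 0 < a := by rw [ha]; positivity
  have ha12 : a < 1 / 2 := by rw [ha]; linarith
  obtain ⟨δ₀, hδ₀⟩ := lemme_3_8 θ ha0 ha12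
  refine ⟨max δ₀ 1, ?_⟩
  intro δ hδ μ hμ
  have hδ1 : 1 ≤ δ := (le_max_right _ _).trans hδ
  obtain ⟨P, hP0, hPdeg, hPM, hPsmall⟩ := hδ₀ δ ((le_max_left _ _).trans hδ) μ hμ
  have hδpos : (0 : ℝ) < δ := by exact_mod_cast hδ1
  have hμpos : 0 < μ := hδpos.trans_le hμ
  have hbδμ : 0 ≤ b * δ * μ := by positivity
  -- any irreducible-power factor of `P` has small degree and Mahler measure
  have hfactor : ∀ Q : ℤ[X], Q ∣ P → Q.natDegree ≤ δ ∧
      Real.log (Q.map (Int.castRingHom ℂ)).mahlerMeasure ≤ μ := by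
    intro Q hQ
    refine ⟨(natDegree_le_of_dvd hQ hP0).trans hPdeg, ?_⟩
    have h := Polynomial.logMahlerMeasure_map_le_of_dvd hP0 hQ
    rw [logMahlerMeasure_eq_log_MahlerMeasure, logMahlerMeasure_eq_log_MahlerMeasure] at h
    exact h.trans hPM
  -- it suffices to find an irreducible power dividing `P` which is small at `θ`
  suffices H : ∃ (R : ℤ[X]) (k : ℕ), Irreducible R ∧ 0 < k ∧ R ^ k ∣ P ∧
      ‖aeval θ (R ^ k)‖ ≤ Real.exp (-(b * δ * μ)) by
    obtain ⟨R, k, hR, hk, hdvd, hsmall⟩ := H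
    obtain ⟨hd, hM⟩ := hfactor _ hdvd
    exact ⟨R ^ k, pow_ne_zero _ hR.ne_zero, ⟨R, k, hR, hk, rfl⟩, hd, hM, hsmall⟩
  -- the blocks
  set NF := normalizedFactors P with hNF
  set T : Finset ℤ[X] := NF.toFinset with hT
  set c : ℤ[X] → ℕ := fun q => NF.count q with hc
  set B : ℤ[X] → ℤ[X] := fun q => q ^ c q with hB
  have hirr : ∀ q ∈ T, Irreducible q := fun q hq =>
    irreducible_of_normalized_factor q (Multiset.mem_toFinset.mp hq)
  have hnorm : ∀ q ∈ T, normalize q = q := fun q hq =>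
    normalize_normalized_factor q (Multiset.mem_toFinset.mp hq)
  have hcpos : ∀ q ∈ T, 0 < c q := fun q hq =>
    Multiset.count_pos.mpr (Multiset.mem_toFinset.mp hq)
  have hprod : Associated (∏ q ∈ T, B q) P := by
    have := prod_normalizedFactors hP0
    rwa [Finset.prod_multiset_count] at this
  obtain ⟨u, hu⟩ := hprod
  -- `P = (∏ B q) * u`
  have hPu : P = (∏ q ∈ T, B q) * u := hu.symm
  have hBdvd : ∀ q ∈ T, B q ∣ P := fun q hq => by
    rw [hPu]; exact (Finset.dvd_prod_of_mem B hq).mul_right _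
  -- case: some irreducible factor vanishes at `θ`
  by_cases hvan : ∃ q ∈ T, aeval θ q = 0
  · obtain ⟨q, hq, hq0⟩ := hvan
    refine ⟨q, 1, hirr q hq, one_pos, ?_, ?_⟩
    · rw [pow_one]; exact (dvd_pow_self q (hcpos q hq).ne').trans (hBdvd q hq)
    · rw [pow_one, hq0, norm_zero]; exact (Real.exp_pos _).le
  push Not at hvan
  have hBval : ∀ q ∈ T, 0 < ‖aeval θ (B q)‖ := fun q hq => by
    rw [hB]; simp only [map_pow, norm_pow]; exact pow_pos (norm_pos_iff.mpr (hvan q hq)) _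
  -- non-constant blocks and their closest roots
  set Tnc : Finset ℤ[X] := T.filter fun q => 0 < q.natDegree with hTnc
  have hroots : ∀ q ∈ Tnc, (q.map (Int.castRingHom ℂ)).roots ≠ 0 := by
    intro q hq
    obtain ⟨hqT, hqd⟩ := Finset.mem_filter.mp hq
    rw [Ne, ← Multiset.card_eq_zero, card_roots_eq,
      natDegree_map_eq_of_injective (RingHom.injective_int _)]
    omega
  have hαex : ∀ q : ℤ[X], ∃ α : ℂ, q ∈ Tnc → α ∈ (q.map (Int.castRingHom ℂ)).roots ∧
      ∀ β ∈ (q.map (Int.castRingHom ℂ)).roots, ‖θ - α‖ ≤ ‖θ - β‖ := by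
    intro q
    by_cases hq : q ∈ Tnc
    · obtain ⟨α, hα, hmin⟩ := Finset.exists_min_image (q.map (Int.castRingHom ℂ)).roots.toFinset
        (fun z => ‖θ - z‖) (by
          obtain ⟨z, hz⟩ := Multiset.exists_mem_of_ne_zero (hroots q hq)
          exact ⟨z, Multiset.mem_toFinset.mpr hz⟩)
      exact ⟨α, fun _ => ⟨Multiset.mem_toFinset.mp hα, fun β hβ => hmin β (Multiset.mem_toFinset.mpr hβ)⟩⟩
    · exact ⟨0, fun h => absurd h hq⟩
  choose α hα using hαex
  set d : ℤ[X] → ℝ := fun q => ‖θ - α q‖ with hd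
  -- the (at most) four closest blocks
  set k₀ := min 4 Tnc.card with hk₀
  obtain ⟨S, hSsub, hScard, hSord⟩ := exists_smallest_finset Tnc d k₀ (min_le_right _ _)
  have hST : S ⊆ T := hSsub.trans (Finset.filter_subset _ _)
  set F : ℤ[X] := ∏ q ∈ S, B q with hF
  set G : ℤ[X] := (∏ q ∈ T \ S, B q) * u with hG
  have hFG : F * G = P := by
    rw [hF, hG, ← mul_assoc, mul_comm (∏ q ∈ S, B q), Finset.prod_sdiff hST, hPu]
  have hF0 : F ≠ 0 := by intro h; rw [h, zero_mul] at hFG; exact hP0 hFG.symm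
  have hG0 : G ≠ 0 := by intro h; rw [h, mul_zero] at hFG; exact hP0 hFG.symm
  have hFpos : 0 < ‖aeval θ F‖ := by
    rw [hF, map_prod, norm_prod]; exact Finset.prod_pos fun q hq => hBval q (hST hq)
  have hGpos : 0 < ‖aeval θ G‖ := by
    rw [hG, map_mul, norm_mul, map_prod, norm_prod]
    refine mul_pos (Finset.prod_pos fun q hq => hBval q (Finset.mem_sdiff.mp hq).1) ?_
    rw [Polynomial.norm_aeval_of_isUnit u.isUnit θ]; exact one_pos
  have hPval : ‖aeval θ P‖ = ‖aeval θ F‖ * ‖aeval θ G‖ := by rw [← hFG, map_mul, norm_mul]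
  -- `log |F(θ)| ≤ -4 b δ μ`
  have hFsmall : Real.log ‖aeval θ F‖ ≤ -(4 * b * δ * μ) := by
    have hPlog : Real.log ‖aeval θ P‖ ≤ -(a * δ * μ) := by
      have := Real.log_le_log (by rw [hPval]; exact mul_pos hFpos hGpos) hPsmall
      rwa [Real.log_exp] at this
    rw [hPval, Real.log_mul hFpos.ne' hGpos.ne'] at hPlog
    -- `log |G(θ)| ≥ -δμ/4`
    suffices hGlog : -(δ * μ / 4) ≤ Real.log ‖aeval θ G‖ by
      rw [ha] at hPlog; nlinarith
    by_cases hk4 : Tnc.card < 4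
    · -- fewer than four non-constant blocks: `G` is a non-zero constant
      have hS : S = Tnc := Finset.eq_of_subset_of_card_le hSsub (by rw [hScard, hk₀]; omega)
      have hprodne : ∏ q ∈ T \ S, B q ≠ 0 :=
        Finset.prod_ne_zero_iff.mpr fun q hq => pow_ne_zero _ (hirr q (Finset.mem_sdiff.mp hq).1).ne_zero
      have hGdeg : G.natDegree = 0 := by
        rw [hG, natDegree_mul hprodne (Units.ne_zero u), natDegree_eq_zero_of_isUnit u.isUnit, add_zero,
          natDegree_prod _ _ (fun q hq => pow_ne_zero _ (hirr q (Finset.mem_sdiff.mp hq).1).ne_zero)]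
        refine Finset.sum_eq_zero fun q hq => ?_
        obtain ⟨hqT, hqS⟩ := Finset.mem_sdiff.mp hq
        have hq0 : q.natDegree = 0 := by
          by_contra hne
          exact hqS (hS ▸ Finset.mem_filter.mpr ⟨hqT, Nat.pos_of_ne_zero hne⟩)
        simp [natDegree_pow, hq0]
      have h1 := Polynomial.one_le_norm_aeval_of_natDegree_eq_zero hG0 hGdeg θ
      have : 0 ≤ Real.log ‖aeval θ G‖ := Real.log_nonneg h1
      have : 0 ≤ (δ : ℝ) * μ / 4 := by positivity
      linarith
    · -- four blocks: Lemme 3.4 with their closest roots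
      push Not at hk4
      have hS4 : S.card = 4 := by rw [hScard, hk₀, min_eq_left hk4]
      set Fc := F.map (Int.castRingHom ℂ) with hFc
      set Gc := G.map (Int.castRingHom ℂ) with hGc
      have hFc0 : Fc ≠ 0 := (Polynomial.map_ne_zero_iff (RingHom.injective_int _)).mpr hF0
      have hGc0 : Gc ≠ 0 := (Polynomial.map_ne_zero_iff (RingHom.injective_int _)).mpr hG0
      -- roots of `Fc` and `Gc`
      have hFcprod : Fc = ∏ q ∈ S, (q.map (Int.castRingHom ℂ)) ^ c q := by
        rw [hFc, hF, Polynomial.map_prod]; simp only [hB, Polynomial.map_pow]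
      obtain ⟨w, hw, hwu⟩ := Polynomial.isUnit_iff.mp u.isUnit
      have hGcprod : Gc = C (w : ℂ) * ∏ q ∈ T \ S, (q.map (Int.castRingHom ℂ)) ^ c q := by
        rw [hGc, hG, Polynomial.map_mul, ← hwu, map_C, eq_intCast, Polynomial.map_prod, mul_comm]
        simp only [hB, Polynomial.map_pow]
      have hw0 : ((w : ℤ) : ℂ) ≠ 0 := by exact_mod_cast hw.ne_zero
      have hFroots : Fc.roots = S.val.bind fun q => c q • (q.map (Int.castRingHom ℂ)).roots := by
        rw [hFcprod, roots_prod _ _ (hFcprod ▸ hFc0)]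
        simp only [roots_pow]
      have hGroots : Gc.roots = (T \ S).val.bind fun q => c q • (q.map (Int.castRingHom ℂ)).roots := by
        have hne : ∏ q ∈ T \ S, (q.map (Int.castRingHom ℂ)) ^ c q ≠ 0 := by
          intro h0; rw [h0, mul_zero] at hGcprod; exact hGc0 hGcprod
        rw [hGcprod, roots_C_mul _ hw0, roots_prod _ _ hne]
        simp only [roots_pow]
      -- the close roots
      set A : Multiset ℂ := S.val.map α with hA
      have hAle : A ≤ Fc.roots := by
        rw [hA, hFroots, ← bind_singleton]
        refine bind_mono _ fun q hq => ?_
        have hq' : q ∈ Tnc := hSsub (Finset.mem_def.mpr hq)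
        have h1 : ({α q} : Multiset ℂ) ≤ (q.map (Int.castRingHom ℂ)).roots :=
          Multiset.singleton_le.mpr (hα q hq').1
        refine h1.trans ?_
        have hc1 : 1 ≤ c q := hcpos q (hST (Finset.mem_def.mpr hq))
        calc (q.map (Int.castRingHom ℂ)).roots = 1 • (q.map (Int.castRingHom ℂ)).roots := (one_nsmul _).symm
          _ ≤ c q • (q.map (Int.castRingHom ℂ)).roots := nsmul_le_nsmul_left (Multiset.zero_le _) hc1
      have hAcard : card A = 4 := by rw [hA, card_map, Finset.card_val, hS4]
      have hAB : ∀ α' ∈ A, ∀ β ∈ Gc.roots - 0, ‖θ - α'‖ ≤ ‖θ - β‖ := by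
        intro α' hα' β hβ
        rw [tsub_zero, hGroots, Multiset.mem_bind] at hβ
        obtain ⟨q', hq', hβq'⟩ := hβ
        rw [hA, Multiset.mem_map] at hα'
        obtain ⟨q, hq, rfl⟩ := hα'
        have hβroot : β ∈ (q'.map (Int.castRingHom ℂ)).roots := Multiset.mem_of_mem_nsmul hβq'
        have hq'T : q' ∈ T \ S := Finset.mem_def.mpr hq'
        obtain ⟨hq'T', hq'S⟩ := Finset.mem_sdiff.mp hq'T
        have hq'nc : q' ∈ Tnc := by
          refine Finset.mem_filter.mpr ⟨hq'T', ?_⟩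
          rw [← natDegree_map_eq_of_injective (RingHom.injective_int (Int.castRingHom ℂ)) q', ← card_roots_eq]
          exact Multiset.card_pos.mpr (by rintro h; rw [h] at hβroot; exact Multiset.notMem_zero _ hβroot)
        have hqS : q ∈ S := Finset.mem_def.mpr hq
        calc ‖θ - α q‖ = d q := rfl
          _ ≤ d q' := hSord q hqS q' (Finset.mem_sdiff.mpr ⟨hq'nc, hq'S⟩)
          _ ≤ ‖θ - β‖ := (hα q' hq'nc).2 β hβroot
      have h34 := resultant_wirsing Fc Gc hFc0 hGc0 θ A 0 hAle (Multiset.zero_le _) 0 le_rfl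
        (fun _ _ => norm_nonneg _) (fun _ _ => norm_nonneg _) hAB
        (fun β hβ => absurd hβ (Multiset.notMem_zero β))
      rw [hAcard] at h34
      simp only [card_zero, mul_zero, pow_zero, one_mul, tsub_zero, mul_one] at h34
      -- coprimality over `ℚ`
      have hcop : IsCoprime (F.map (Int.castRingHom ℚ)) (G.map (Int.castRingHom ℚ)) := by
        rw [hF, hG, Polynomial.map_prod, Polynomial.map_mul, Polynomial.map_prod]
        refine IsCoprime.prod_left fun q hq => IsCoprime.mul_right (IsCoprime.prod_right fun q' hq' => ?_)
          (isCoprime_of_isUnit_right _ ((u.isUnit).map (mapRingHom (Int.castRingHom ℚ))))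
        simp only [hB, Polynomial.map_pow]
        refine IsCoprime.pow ?_
        have hqT : q ∈ T := hST hq
        obtain ⟨hq'T, hq'S⟩ := Finset.mem_sdiff.mp hq'
        have hne : q ≠ q' := fun h => hq'S (h ▸ hq)
        have hqd : 0 < q.natDegree := (Finset.mem_filter.mp (hSsub hq)).2
        by_cases hq'd : q'.natDegree = 0
        · -- `q'` is a constant (a prime number): a unit over `ℚ`
          have hq'c : q' = C (q'.coeff 0) := eq_C_of_natDegree_eq_zero hq'd
          have hc0 : q'.coeff 0 ≠ 0 := by
            intro h0; exact (hirr q' hq'T).ne_zero (by rw [hq'c, h0, C_0])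
          refine isCoprime_of_isUnit_right _ ?_
          rw [hq'c, map_C]
          exact isUnit_C.mpr (IsUnit.mk0 _ (by rw [eq_intCast]; exact_mod_cast hc0))
        · by_contra hnc
          have hass := Polynomial.associated_of_not_isCoprime (hirr q hqT) (hirr q' hq'T) hqd
            (Nat.pos_of_ne_zero hq'd) hnc
          exact hne (by rw [← hnorm q hqT, ← hnorm q' hq'T]; exact normalize_eq_normalize hass.dvd hass.symm.dvd)
      have hres := one_le_norm_resultant_map F G hcop
      -- the inequality `1 ≤ 2^{mn} M(F)^n M(G)^{m-4} |G(θ)|^4`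
      have hGθ : ‖Gc.eval θ‖ = ‖aeval θ G‖ := by rw [hGc, eval_map, ← algebraMap_int_eq, ← aeval_def]
      set m := Fc.natDegree with hm
      set n := Gc.natDegree with hn
      have hMF1 : 1 ≤ Fc.mahlerMeasure := one_le_mahlerMeasure_of_ne_zero hF0
      have hMG1 : 1 ≤ Gc.mahlerMeasure := one_le_mahlerMeasure_of_ne_zero hG0
      have h1 : 1 ≤ 2 ^ (m * n) * Fc.mahlerMeasure ^ n * Gc.mahlerMeasure ^ (m - 4) * ‖aeval θ G‖ ^ 4 := by
        rw [← hGθ]; exact hres.trans h34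
      have hlog := Real.log_le_log one_pos h1
      rw [Real.log_one, Real.log_mul (by positivity) (pow_ne_zero _ hGpos.ne'),
        Real.log_mul (by positivity) (by positivity), Real.log_mul (by positivity) (by positivity),
        Real.log_pow, Real.log_pow, Real.log_pow, Real.log_pow, Nat.cast_mul] at hlog
      -- degrees and Mahler measures of `F`, `G`
      have hmn : (m : ℝ) + n ≤ δ := by
        have : m + n = P.natDegree := by
          rw [hm, hn, natDegree_map_eq_of_injective (RingHom.injective_int _),
            natDegree_map_eq_of_injective (RingHom.injective_int _), ← natDegree_mul hF0 hG0, hFG]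
        exact_mod_cast this.le.trans hPdeg
      have huv : Real.log Fc.mahlerMeasure + Real.log Gc.mahlerMeasure ≤ μ := by
        have hmul : (P.map (Int.castRingHom ℂ)).mahlerMeasure = Fc.mahlerMeasure * Gc.mahlerMeasure := by
          rw [← hFG, Polynomial.map_mul, mahlerMeasure_mul]
        rw [← Real.log_mul (by positivity) (by positivity), ← hmul]
        exact hPM
      have hu0 : 0 ≤ Real.log Fc.mahlerMeasure := Real.log_nonneg hMF1
      have hv0 : 0 ≤ Real.log Gc.mahlerMeasure := Real.log_nonneg hMG1
      have hm4 : ((m - 4 : ℕ) : ℝ) ≤ m := by exact_mod_cast Nat.sub_le m 4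
      have hm0 : (0 : ℝ) ≤ m := Nat.cast_nonneg _
      have hn0 : (0 : ℝ) ≤ n := Nat.cast_nonneg _
      have hlog2 : Real.log 2 < 0.7 := by have := Real.log_two_lt_d9; linarith
      have hlog20 : 0 ≤ Real.log 2 := Real.log_nonneg (by norm_num)
      have hbound := deg_mahler_bound hm0 hn0 hu0 hv0 hmn hμ huv
      have hX : (m : ℝ) * n * Real.log 2 + n * Real.log Fc.mahlerMeasure +
          ((m - 4 : ℕ) : ℝ) * Real.log Gc.mahlerMeasure ≤ δ * μ := by
        nlinarith [mul_le_mul_of_nonneg_right hm4 hv0, mul_nonneg hm0 hn0]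
      push_cast at hlog
      linarith
  -- one of the blocks of `F` is small
  have hk₀pos : 0 < k₀ := by
    rw [hk₀]
    refine lt_min (by norm_num) (Finset.card_pos.mpr ?_)
    -- if all blocks were constant, `P` would be constant and `|P(θ)| ≥ 1`
    by_contra hemp
    rw [Finset.not_nonempty_iff_eq_empty] at hemp
    have hPdeg0 : P.natDegree = 0 := by
      rw [hPu, natDegree_mul (by intro h; rw [h, zero_mul] at hPu; exact hP0 hPu) (Units.ne_zero u),
        natDegree_eq_zero_of_isUnit u.isUnit, add_zero,
        natDegree_prod _ _ (fun q hq => pow_ne_zero _ (hirr q hq).ne_zero)]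
      refine Finset.sum_eq_zero fun q hq => ?_
      have hq0 : q.natDegree = 0 := by
        by_contra hne
        have : q ∈ Tnc := Finset.mem_filter.mpr ⟨hq, Nat.pos_of_ne_zero hne⟩
        rw [hemp] at this; exact Finset.notMem_empty _ this
      simp [natDegree_pow, hq0]
    have h1 := Polynomial.one_le_norm_aeval_of_natDegree_eq_zero hP0 hPdeg0 θ
    have h2 : Real.exp (-(a * δ * μ)) < 1 := Real.exp_lt_one_iff.mpr (by
      have : 0 < a * δ * μ := by positivity
      linarith)
    linarith
  have hSne : S.Nonempty := Finset.card_pos.mp (by rw [hScard]; exact hk₀pos)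
  have hk₀4 : (k₀ : ℝ) ≤ 4 := by exact_mod_cast min_le_left 4 Tnc.card
  have hsum : ∑ q ∈ S, Real.log ‖aeval θ (B q)‖ ≤ ∑ _q ∈ S, (-(b * δ * μ)) := by
    have hlogF : Real.log ‖aeval θ F‖ = ∑ q ∈ S, Real.log ‖aeval θ (B q)‖ := by
      rw [hF, map_prod, norm_prod, Real.log_prod]
      exact fun q hq => (hBval q (hST hq)).ne'
    rw [← hlogF, Finset.sum_const, nsmul_eq_mul, hScard]
    calc Real.log ‖aeval θ F‖ ≤ -(4 * b * δ * μ) := hFsmall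
      _ ≤ (k₀ : ℝ) * -(b * δ * μ) := by nlinarith
  obtain ⟨q, hqS, hq⟩ := Finset.exists_le_of_sum_le hSne hsum
  refine ⟨q, c q, hirr q (hST hqS), hcpos q (hST hqS), hBdvd q (hST hqS), ?_⟩
  have := Real.exp_le_exp.mpr hq
  rwa [Real.exp_log (hBval q (hST hqS))] at this

end RoyWaldschmidt1997

end Literature.NumberTheory.Transcendental
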